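import Summits.BirchSwinnertonDyer.BirchSwinnertonDyer.Theorems.PrintX11aUpperNonSurjFiveTwoCores
import HarnessLib

/-!
# Route `PrintX11a`, crux U5 = `Theses.PrintX11a.UpperNonSurjFive` (item stmt-BirchSwinnertonDyer-20614), line of record «gl1cartan5» (REV 12):
# the STRATA of the Tamagawa-depth core C_cc — T1 «exactly one split multiplicative prime» ⊔ T2 «two split multiplicative primes» — as kernel theorems,
# and a BY-NAME socket «`ord_p L(E,1)/Ω_E ≥ ord_p ∏ c_ℓ` ⟹ C_cc» for any additivity input

Cell `bsd-print-x11a`, LEAD `cruxlead-stmt-BirchSwinnertonDyer-20614` g8 (`--supports stmt-BirchSwinnertonDyer-20614 --as helper`).  THEOREMS ONLY (no definition, no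
named fact minted, no `sorry`); sequel of `Theorems/PrintX11aUpperNonSurjFiveTwoCores.lean` (g7, p691730).  REV 12 of the line leaves two cores open: C_Ш «X11a ∧ ¬Surj ∧
`5 ≤ p` ∧ `Ш(E)[p] ≠ 0` ⟹ `MissingUpperBoundAt`» and C_cc «X11a ∧ ¬Surj ∧ `5 ≤ p` ∧ `Ш(E)[p] = 0` ∧ `ord_p ∏_ℓ c_ℓ ≥ 2` ⟹ `MissingUpperBoundAt`».  The lead's
diagnosis (`Cruxes/UpperNonSurjFive/CORES-DIAGNOSIS-cruxlead-g7.md`) splits C_cc by the NUMBER of split multiplicative primes, because the two strata face different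
walls; this file puts that split in the kernel.

* §1 (fact-free local structure on X11a ∧ ¬Surj, `p ≥ 5`).  `dvd_padicValInt_minimalDiscriminantInt_of_classX11a_of_not_surj_of_split`: EVERY split multiplicative
  prime `ℓ` has `p ∣ v_ℓ(Δ_min) = c_ℓ` (`ℓ ≠ p`: no (ram) witness; `ℓ = p`: Tate — otherwise inertia at `p` contains a transvection and `ρ̄` is onto).
  `two_le_padicValNat_tamagawaProduct_of_two_split`: two distinct split multiplicative primes force `ord_p ∏ c ≥ 2` (Kodaira–Néron: `c_ℓ = v_ℓ(Δ_min)` at a split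
  `ℓ`, the two factors are distinct factors of the finite product).  `depthStrata_of_two_le_padicValNat_tamagawaProduct`: conversely `ord_p ∏ c ≥ 2` forces EITHER a
  split multiplicative `ℓ` with `p² ∣ v_ℓ(Δ_min)` (stratum T1 when it is the only split prime) OR two distinct split multiplicative primes (stratum T2)
  (Kodaira–Néron: `p ≥ 5` divides `c_ℓ` only at split `ℓ`).
* §2 (fact-free) `tamagawaDepthCore_iff_strata`: C_cc ⟺ C_T1 ∧ C_T2, where C_T1 := «X11a ∧ ¬Surj ∧ `5 ≤ p` ∧ `ord_p ∏c ≥ 2` ∧ `Ш(E)[p] = 0` ∧ AT MOST ONE split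
  multiplicative prime ⟹ `MissingUpperBoundAt`» and C_T2 := «X11a ∧ ¬Surj ∧ `5 ≤ p` ∧ `Ш(E)[p] = 0` ∧ TWO distinct split multiplicative primes ⟹ `MissingUpperBoundAt`»
  (no depth binder in C_T2: it is automatic by §1).  CENSUS (`N < 5·10⁵`, `p = 5`, tree records `RecordsLeafNonSurjN500000Part1–2`): C_T1 is EMPTY; C_T2 = {118080ds1
  (split at 5 and 41, `c₅ = c₄₁ = 5`), 346560lh1 (split at 3 and 5, `c₃ = 5`, `c₅ = 10`)}, both with `#Ш_an = 1`.  WALLS: T1 = a level-lowering congruence modulo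
  `pⁿ` at ONE prime (`ρ_{E,pⁿ}` unramified at `ℓ` iff `pⁿ ∣ c_ℓ`) plus a canonical-period congruence modulo `pⁿ` — single-eigenform shape, not in print at `p ∥ N`;
  T2 = a mechanism MULTIPLICATIVE over the primes (no congruence of `f_E` with one eigenform reaches `Σᵢ ord_p c_{ℓᵢ}`: modulo `𝔭ⁿ` it yields `maxᵢ`) — the control
  theorem of a main conjecture (same wall as C_Ш, barrier `EulerSystemBigImageAtSmallImage`), an exact Ribet–Takahashi degree formula with a `p`-unit twisted value
  (parity-blocked on both census pairs), or old-ideal PRODUCT membership of the winding element (line «oldprod5», its KEY stub (W)).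
* §3 (CONDITIONAL on GZK, modularity, Mazur Cor. 4.1 — displayed) the SOCKETS: `missingUpperBoundAt_of_valueDepth` (per pair: `Ш(E)[p] = 0` and
  «`ord_p ∏c ≤ ord_p (L(E,1)/Ω_E)`» ⟹ `MissingUpperBoundAt`, through `ord_p #Ш_an = ord_p (L/Ω) − ord_p ∏c` and the door `ClassX11a.missingUpperBoundAt_of_noPTorsion`),
  `tamagawaDepthCore_of_valueDepth` (class-wide on the C_cc locus), `twoSplitCore_of_valueDepth` (on the T2 locus) — the statement an additivity road must deliver,
  BY NAME, to close C_cc or its populated stratum.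
* §4 `upperNonSurjFive_of_elevenFacts_of_shaCore_of_strata` — PLANNER TURNKEY: the eleven named facts + C_Ш + C_T1 + C_T2 ⟹ U5 BY NAME
  (through `upperNonSurjFive_of_elevenFacts_of_twoCores`).

HONEST FRAMING: every positive statement is CONDITIONAL on the displayed named facts and ∕ or on the OPEN cores ∕ strata, which are U5 verbatim on sub-loci; nothing is
asserted about any curve; item 20614 is NOT closed by this file; BSD is not proved by any of this; nothing here bounds a non-trivial `Ш`.
[cite: SilvermanATAEC1994, Cor. IV.9.2 (d) and Table 4.1] [cite: Miller2011LMS, Def. 1.1 (arXiv:1010.2431 p. 3)] [cite: Kato2004Asterisque, §17.13 (pp. 279–280)]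
[cite: Ribet1990, Thm. 1.1] [cite: Serre1972, §2.4 Prop. 15]
-/

set_option linter.dupNamespace false
set_option autoImplicit false

noncomputable section

open scoped Classical

open IsDedekindDomain WeierstrassCurve Rat.HeightOneSpectrum
  Literature.NumberTheory.EllipticCurves
  Literature.NumberTheory.EllipticCurves.ModularForms
  Literature.NumberTheory.EllipticCurves.Rank1Residual
  Literature.NumberTheory.EllipticCurves.Rank1Residual.Typed
  Literature.NumberTheory.EllipticCurves.SteinWuthrich2013
  Literature.NumberTheory.EllipticCurves.Kato2004
  Literature.NumberTheory.EllipticCurves.Wuthrich2014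
  Summit.BirchSwinnertonDyer.Rank1Residual
  Summit.BirchSwinnertonDyer.BirchSwinnertonDyer.Theses

namespace Summit.BirchSwinnertonDyer.BirchSwinnertonDyer.Theorems.GL1Cartan

/-! ## §1 Local structure of the Tamagawa depth on X11a ∧ ¬Surj (fact-free) -/

/-- **On X11a with `ρ̄_{E,p}` not surjective, every split multiplicative prime `ℓ` has `p ∣ v_ℓ(Δ_min)`** (`= c_ℓ` by Kodaira–Néron): at `ℓ ≠ p` this is the
absence of a (ram) witness (`ClassX11a` carries `¬ Ram`), at `ℓ = p` it is Tate's transvection (`ClassX11a.surj_of_not_dvd`: `p ∤ v_p(Δ_min)` at a multiplicative `p`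
with `E[p]` irreducible makes `ρ̄` onto). [cite: Serre1972, §2.4 Prop. 15] [cite: SilvermanATAEC1994, V.6 Prop. 6.1] -/
theorem dvd_padicValInt_minimalDiscriminantInt_of_classX11a_of_not_surj_of_split
    {W : WeierstrassCurve ℚ} [W.IsElliptic] [W.IsGloballyMinimal] {p : ℕ} [Fact p.Prime]
    (hX : ClassX11a W p) (hns : ¬ Surj W p) {ℓ : ℕ} [hℓ : Fact ℓ.Prime] (hs : W.HasSplitMultiplicativeReductionAtPrime ℓ) :
    p ∣ padicValInt ℓ W.minimalDiscriminantInt := by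
  by_cases hℓp : ℓ = p
  · subst hℓp
    by_contra hnd
    exact hns (ClassX11a.surj_of_not_dvd W ℓ hX hnd)
  · by_contra hnd
    exact hX.not_ram ⟨ℓ, hℓ, hℓp, hs.hasMultiplicativeReductionAtPrime, hnd⟩

/-- The `ℓ`-adic local Tamagawa number at the place of `ℤ` above a split multiplicative prime `ℓ` is `v_ℓ(Δ_min)` (Kodaira–Néron), in the dependent currency of
the finite product `tamagawaProduct_eq_prod` (the prime read off the place). [cite: SilvermanATAEC1994, Cor. IV.9.2 (d) with (b)] -/
theorem localTamagawaNumber_primesEquiv_eq_padicValInt_of_split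
    (W : WeierstrassCurve ℚ) [W.IsElliptic] [W.IsGloballyMinimal] (v : HeightOneSpectrum ℤ) {ℓ : ℕ} [Fact ℓ.Prime]
    (hv : (primesEquiv v : ℕ) = ℓ) (hs : W.HasSplitMultiplicativeReductionAtPrime ℓ) :
    (haveI := Fact.mk (primesEquiv v).2
     (W.baseChange ℚ_[primesEquiv v]).localTamagawaNumber ℤ_[primesEquiv v]) = padicValInt ℓ W.minimalDiscriminantInt := by
  have key : ∀ (q : ℕ) (hq : Fact q.Prime), (primesEquiv v : ℕ) = q →
      @WeierstrassCurve.HasSplitMultiplicativeReductionAtPrime W q hq →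
      @WeierstrassCurve.localTamagawaNumber ℤ_[q] _ _ _ ℚ_[q] _ _ _ (W.baseChange ℚ_[q]) =
        padicValInt q W.minimalDiscriminantInt := by
    intro q hq hq' hsq
    exact X11b.localTamagawaNumber_eq_padicValInt_of_split W v hq' hsq
  have h := key ℓ _ hv hs
  subst hv
  exact h

/-- A prime `p ≥ 5` dividing the local Tamagawa number at the place of `ℤ` above `ℓ` forces split multiplicative reduction at `ℓ` (Kodaira–Néron: `c_ℓ ≤ 4`
otherwise), in the dependent currency of `tamagawaProduct_eq_prod`. [cite: SilvermanATAEC1994, Cor. IV.9.2 (d)] -/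
theorem hasSplitMultiplicativeReductionAtPrime_primesEquiv_of_dvd_localTamagawaNumber
    (W : WeierstrassCurve ℚ) [W.IsElliptic] (v : HeightOneSpectrum ℤ) {p : ℕ} (hp5 : 5 ≤ p)
    (h : p ∣ (haveI := Fact.mk (primesEquiv v).2
      (W.baseChange ℚ_[primesEquiv v]).localTamagawaNumber ℤ_[primesEquiv v])) :
    (haveI := Fact.mk (primesEquiv v).2; W.HasSplitMultiplicativeReductionAtPrime (primesEquiv v : ℕ)) := by
  haveI := Fact.mk (primesEquiv v).2
  haveI : (W.baseChange ℚ_[(primesEquiv v : ℕ)]).IsElliptic :=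
    inferInstanceAs (W.map (algebraMap ℚ ℚ_[(primesEquiv v : ℕ)])).IsElliptic
  exact X11b.hasSplitMultiplicativeReduction_of_five_le_of_dvd_localTamagawaNumber _ _ hp5 h

/-- **Two distinct split multiplicative primes force `ord_p ∏_ℓ c_ℓ ≥ 2` on X11a ∧ ¬Surj (`p ≥ 5`)** — stratum T2 lies inside the depth core automatically: each of
`c_{ℓ₁} = v_{ℓ₁}(Δ_min)`, `c_{ℓ₂} = v_{ℓ₂}(Δ_min)` is divisible by `p` (§1) and they are two distinct factors of the finite product `∏_v c_v`.
[cite: SilvermanATAEC1994, Cor. IV.9.2 (d) and Table 4.1] [cite: Serre1972, §2.4 Prop. 15] -/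
theorem two_le_padicValNat_tamagawaProduct_of_two_split
    {W : WeierstrassCurve ℚ} [W.IsElliptic] [W.IsGloballyMinimal] {p : ℕ} [Fact p.Prime]
    (hX : ClassX11a W p) (hns : ¬ Surj W p)
    {ℓ₁ : ℕ} [Fact ℓ₁.Prime] {ℓ₂ : ℕ} [Fact ℓ₂.Prime] (hne : ℓ₁ ≠ ℓ₂)
    (hs₁ : W.HasSplitMultiplicativeReductionAtPrime ℓ₁) (hs₂ : W.HasSplitMultiplicativeReductionAtPrime ℓ₂) :
    2 ≤ padicValNat p W.tamagawaProduct := by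
  -- the places of `ℤ` above `ℓ₁`, `ℓ₂`
  obtain ⟨v₁, hv₁⟩ : ∃ v : HeightOneSpectrum ℤ, (primesEquiv v : ℕ) = ℓ₁ :=
    ⟨primesEquiv.symm ⟨ℓ₁, Fact.out⟩, by rw [Equiv.apply_symm_apply]⟩
  obtain ⟨v₂, hv₂⟩ : ∃ v : HeightOneSpectrum ℤ, (primesEquiv v : ℕ) = ℓ₂ :=
    ⟨primesEquiv.symm ⟨ℓ₂, Fact.out⟩, by rw [Equiv.apply_symm_apply]⟩
  have hv : v₁ ≠ v₂ := by
    rintro rfl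
    exact hne (hv₁.symm.trans hv₂)
  -- the finite product over the bad places and `v₁`, `v₂`
  have hfW : (W.badPlaces ℤ).Finite := W.finite_badPlaces_holds ℤ
  set s : Finset (HeightOneSpectrum ℤ) := insert v₁ (insert v₂ hfW.toFinset) with hsdef
  have hsW : ∀ w, ¬ W.HasGoodReductionAt w → w ∈ s := fun w hw ↦
    Finset.mem_insert_of_mem (Finset.mem_insert_of_mem (by rw [Set.Finite.mem_toFinset, mem_badPlaces_iff]; exact hw))
  have hsub : ({v₁, v₂} : Finset (HeightOneSpectrum ℤ)) ⊆ s := by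
    intro w hw
    simp only [Finset.mem_insert, Finset.mem_singleton] at hw
    rcases hw with rfl | rfl
    · exact Finset.mem_insert_self _ _
    · exact Finset.mem_insert_of_mem (Finset.mem_insert_self _ _)
  have h0 : W.tamagawaProduct ≠ 0 := (W.tamagawaProduct_pos_holds).ne'
  rw [← padicValNat_dvd_iff_le h0, tamagawaProduct_eq_prod W s hsW]
  refine dvd_trans ?_ (Finset.prod_dvd_prod_of_subset _ _ _ hsub)
  rw [Finset.prod_pair hv, pow_two]
  refine mul_dvd_mul ?_ ?_
  · rw [localTamagawaNumber_primesEquiv_eq_padicValInt_of_split W v₁ hv₁ hs₁]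
    exact dvd_padicValInt_minimalDiscriminantInt_of_classX11a_of_not_surj_of_split hX hns hs₁
  · rw [localTamagawaNumber_primesEquiv_eq_padicValInt_of_split W v₂ hv₂ hs₂]
    exact dvd_padicValInt_minimalDiscriminantInt_of_classX11a_of_not_surj_of_split hX hns hs₂

/-- **The two strata of depth `≥ 2` (any elliptic curve over `ℚ`, `p ≥ 5`; fact-free).**  If `ord_p ∏_ℓ c_ℓ ≥ 2` then EITHER some split multiplicative prime
`ℓ` has `p² ∣ v_ℓ(Δ_min) = c_ℓ` OR there are two distinct split multiplicative primes: `p² ∣ ∏_v c_v` (finite product over the bad places), a prime factor `p ≥ 5`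
of some `c_v` makes `v` split multiplicative with `c_v = v_ℓ(Δ_min)` (Kodaira–Néron), and if no second factor is divisible by `p` then `p² ∣ c_v`.  On X11a ∧ ¬Surj
with EXACTLY one split multiplicative prime this is stratum T1 «`p² ∣ c_ℓ`» (census-empty at `N < 5·10⁵`). [cite: SilvermanATAEC1994, Cor. IV.9.2 (d) and Table 4.1] -/
theorem depthStrata_of_two_le_padicValNat_tamagawaProduct
    (W : WeierstrassCurve ℚ) [W.IsElliptic] [W.IsGloballyMinimal] {p : ℕ} [Fact p.Prime] (hp5 : 5 ≤ p)
    (h2 : 2 ≤ padicValNat p W.tamagawaProduct) :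
    (∃ (ℓ : ℕ) (_ : Fact ℓ.Prime), W.HasSplitMultiplicativeReductionAtPrime ℓ ∧ p ^ 2 ∣ padicValInt ℓ W.minimalDiscriminantInt) ∨
      ∃ (ℓ₁ : ℕ) (_ : Fact ℓ₁.Prime) (ℓ₂ : ℕ) (_ : Fact ℓ₂.Prime), ℓ₁ ≠ ℓ₂ ∧
        W.HasSplitMultiplicativeReductionAtPrime ℓ₁ ∧ W.HasSplitMultiplicativeReductionAtPrime ℓ₂ := by
  have hp : p.Prime := Fact.out
  have h0 : W.tamagawaProduct ≠ 0 := (W.tamagawaProduct_pos_holds).ne'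
  have hp2 : p ^ 2 ∣ W.tamagawaProduct := (padicValNat_dvd_iff_le h0).mpr h2
  -- the finite product over the bad places
  have hfW : (W.badPlaces ℤ).Finite := W.finite_badPlaces_holds ℤ
  set s : Finset (HeightOneSpectrum ℤ) := hfW.toFinset with hsdef
  have hsW : ∀ w, ¬ W.HasGoodReductionAt w → w ∈ s := fun w hw ↦ by
    rw [hsdef, Set.Finite.mem_toFinset, mem_badPlaces_iff]; exact hw
  set c : HeightOneSpectrum ℤ → ℕ := fun v =>
    (haveI := Fact.mk (primesEquiv v).2
     (W.baseChange ℚ_[primesEquiv v]).localTamagawaNumber ℤ_[primesEquiv v]) with hcdef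
  have hprod : W.tamagawaProduct = ∏ v ∈ s, c v := tamagawaProduct_eq_prod W s hsW
  rw [hprod] at hp2
  -- a first factor divisible by `p`
  have hp1 : p ∣ ∏ v ∈ s, c v := dvd_trans (dvd_pow_self p two_ne_zero) hp2
  obtain ⟨v₁, hv₁s, hv₁⟩ := hp.prime.exists_mem_finset_dvd hp1
  haveI i₁ : Fact (primesEquiv v₁ : ℕ).Prime := Fact.mk (primesEquiv v₁).2
  have hs₁ : W.HasSplitMultiplicativeReductionAtPrime (primesEquiv v₁ : ℕ) :=
    hasSplitMultiplicativeReductionAtPrime_primesEquiv_of_dvd_localTamagawaNumber W v₁ hp5 hv₁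
  have hc₁ : c v₁ = padicValInt (primesEquiv v₁ : ℕ) W.minimalDiscriminantInt :=
    localTamagawaNumber_primesEquiv_eq_padicValInt_of_split W v₁ rfl hs₁
  rw [← Finset.mul_prod_erase s c hv₁s] at hp2
  by_cases hrest : p ∣ ∏ v ∈ s.erase v₁, c v
  · -- a second factor divisible by `p`: two distinct split multiplicative primes
    obtain ⟨v₂, hv₂s, hv₂⟩ := hp.prime.exists_mem_finset_dvd hrest
    haveI i₂ : Fact (primesEquiv v₂ : ℕ).Prime := Fact.mk (primesEquiv v₂).2
    have hs₂ : W.HasSplitMultiplicativeReductionAtPrime (primesEquiv v₂ : ℕ) :=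
      hasSplitMultiplicativeReductionAtPrime_primesEquiv_of_dvd_localTamagawaNumber W v₂ hp5 hv₂
    have hne : v₂ ≠ v₁ := Finset.ne_of_mem_erase hv₂s
    refine Or.inr ⟨(primesEquiv v₁ : ℕ), i₁, (primesEquiv v₂ : ℕ), i₂, ?_, hs₁, hs₂⟩
    intro h
    exact hne (primesEquiv.injective (Subtype.ext h)).symm
  · -- no second factor: `p² ∣ c_{v₁} = v_ℓ(Δ_min)`
    have hcop : Nat.Coprime (p ^ 2) (∏ v ∈ s.erase v₁, c v) :=
      Nat.Coprime.pow_left 2 ((Nat.Prime.coprime_iff_not_dvd hp).mpr hrest)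
    refine Or.inl ⟨(primesEquiv v₁ : ℕ), i₁, hs₁, ?_⟩
    rw [← hc₁]
    exact hcop.dvd_of_dvd_mul_right hp2

/-! ## §2 The depth core is exactly its two strata (fact-free) -/

/-- **C_cc ⟺ C_T1 ∧ C_T2 (fact-free).**  C_T1 := U5 at the X11a pairs with `ρ̄` not surjective, `5 ≤ p`, `ord_p ∏c ≥ 2`, `Ш(E)[p] = 0` and AT MOST ONE split
multiplicative prime (then that prime has `p² ∣ c_ℓ`, §1); C_T2 := U5 at the X11a pairs with `ρ̄` not surjective, `5 ≤ p`, `Ш(E)[p] = 0` and TWO distinct split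
multiplicative primes (depth `≥ 2` is automatic, `two_le_padicValNat_tamagawaProduct_of_two_split`).  «⇒»: restriction (T2 through the automatic depth); «⇐»: case
split on «two distinct split multiplicative primes».  Census at `N < 5·10⁵`: C_T1 empty, C_T2 = {118080ds1, 346560lh1}. [cite: Miller2011LMS, Def. 1.1 (arXiv:1010.2431 p. 3)]
[cite: SilvermanATAEC1994, Cor. IV.9.2 (d) and Table 4.1] -/
theorem tamagawaDepthCore_iff_strata :
    (∀ (W : WeierstrassCurve ℚ) [W.IsElliptic] [W.IsGloballyMinimal] (p : ℕ) [Fact p.Prime],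
        ClassX11a W p → ¬ Surj W p → 5 ≤ p → 2 ≤ padicValNat p W.tamagawaProduct →
        (∀ x : W.sha, (p : ℤ) • x = 0 → x = 0) → MissingUpperBoundAt W p) ↔
      ((∀ (W : WeierstrassCurve ℚ) [W.IsElliptic] [W.IsGloballyMinimal] (p : ℕ) [Fact p.Prime],
          ClassX11a W p → ¬ Surj W p → 5 ≤ p → 2 ≤ padicValNat p W.tamagawaProduct →
          (∀ x : W.sha, (p : ℤ) • x = 0 → x = 0) →
          (∀ (ℓ₁ : ℕ) [Fact ℓ₁.Prime] (ℓ₂ : ℕ) [Fact ℓ₂.Prime],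
            W.HasSplitMultiplicativeReductionAtPrime ℓ₁ → W.HasSplitMultiplicativeReductionAtPrime ℓ₂ → ℓ₁ = ℓ₂) →
          MissingUpperBoundAt W p) ∧
        (∀ (W : WeierstrassCurve ℚ) [W.IsElliptic] [W.IsGloballyMinimal] (p : ℕ) [Fact p.Prime],
          ClassX11a W p → ¬ Surj W p → 5 ≤ p → (∀ x : W.sha, (p : ℤ) • x = 0 → x = 0) →
          (∃ (ℓ₁ : ℕ) (_ : Fact ℓ₁.Prime) (ℓ₂ : ℕ) (_ : Fact ℓ₂.Prime), ℓ₁ ≠ ℓ₂ ∧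
            W.HasSplitMultiplicativeReductionAtPrime ℓ₁ ∧ W.HasSplitMultiplicativeReductionAtPrime ℓ₂) →
          MissingUpperBoundAt W p)) := by
  refine ⟨fun h => ⟨fun W _ _ p _ hX hns hp5 h2 hSha _ => h W p hX hns hp5 h2 hSha,
    fun W _ _ p _ hX hns hp5 hSha ⟨ℓ₁, i₁, ℓ₂, i₂, hne, hs₁, hs₂⟩ =>
      h W p hX hns hp5 (two_le_padicValNat_tamagawaProduct_of_two_split hX hns hne hs₁ hs₂) hSha⟩,
    fun ⟨h₁, h₂⟩ W _ _ p _ hX hns hp5 h2 hSha => ?_⟩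
  by_cases htwo : ∃ (ℓ₁ : ℕ) (_ : Fact ℓ₁.Prime) (ℓ₂ : ℕ) (_ : Fact ℓ₂.Prime), ℓ₁ ≠ ℓ₂ ∧
      W.HasSplitMultiplicativeReductionAtPrime ℓ₁ ∧ W.HasSplitMultiplicativeReductionAtPrime ℓ₂
  · exact h₂ W p hX hns hp5 hSha htwo
  · refine h₁ W p hX hns hp5 h2 hSha fun ℓ₁ _ ℓ₂ _ hs₁ hs₂ => ?_
    by_contra hne
    exact htwo ⟨ℓ₁, ‹_›, ℓ₂, ‹_›, hne, hs₁, hs₂⟩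

/-- **On stratum T1 the unique split multiplicative prime is deep: `p² ∣ c_ℓ`** (X11a ∧ ¬Surj is not even needed: any curve, `p ≥ 5`).  So C_T1 quantifies over
the pairs with exactly one split multiplicative prime `ℓ` and `p² ∣ v_ℓ(Δ_min)` — the locus a level-lowering congruence MODULO `p²` at the single prime `ℓ` would pay
(`ρ_{E,p²}` is unramified at `ℓ ≠ p`, resp. finite at `ℓ = p`, iff `p² ∣ v_ℓ(Δ_min)`); census-empty at `N < 5·10⁵`. [cite: SilvermanATAEC1994, Cor. IV.9.2 (d) and Table 4.1]
[cite: Ribet1990, Thm. 1.1] -/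
theorem exists_split_sq_dvd_of_depth_of_atMostOneSplit
    (W : WeierstrassCurve ℚ) [W.IsElliptic] [W.IsGloballyMinimal] {p : ℕ} [Fact p.Prime] (hp5 : 5 ≤ p)
    (h2 : 2 ≤ padicValNat p W.tamagawaProduct)
    (h1 : ∀ (ℓ₁ : ℕ) [Fact ℓ₁.Prime] (ℓ₂ : ℕ) [Fact ℓ₂.Prime],
      W.HasSplitMultiplicativeReductionAtPrime ℓ₁ → W.HasSplitMultiplicativeReductionAtPrime ℓ₂ → ℓ₁ = ℓ₂) :
    ∃ (ℓ : ℕ) (_ : Fact ℓ.Prime), W.HasSplitMultiplicativeReductionAtPrime ℓ ∧ p ^ 2 ∣ padicValInt ℓ W.minimalDiscriminantInt := by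
  rcases depthStrata_of_two_le_padicValNat_tamagawaProduct W hp5 h2 with h | ⟨ℓ₁, i₁, ℓ₂, i₂, hne, hs₁, hs₂⟩
  · exact h
  · exact absurd (h1 ℓ₁ ℓ₂ hs₁ hs₂) hne

/-! ## §3 The sockets: a value-depth (additivity) input closes the depth core (CONDITIONAL on GZK, modularity, Mazur Cor. 4.1) -/

/-- **Per pair: `Ш(E)[p] = 0` and `ord_p ∏_ℓ c_ℓ ≤ ord_p (L(E,1)/Ω_E)` ⟹ `MissingUpperBoundAt` (CONDITIONAL on GZK, modularity, Mazur Cor. 4.1).**  On X11a at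
`p ≥ 5`: `L(E,1)/Ω_E = t ∈ ℚ^×` (modularity + Mazur), `#Ш_an = t·#E(ℚ)²/∏c` (GZK) with `p ∤ #E(ℚ)`, so `ord_p #Ш_an = ord_p t − ord_p ∏c ≥ 0`
(`padicValRat_shaAn_eq_sub_tamagawa`), and the door `ClassX11a.missingUpperBoundAt_of_noPTorsion` concludes.  This is the statement an additivity road
(«`ord_p L(E,1)/Ω_E ≥ Σ_{ℓ split} ord_p c_ℓ`», e.g. line «oldprod5») must deliver at a pair. [cite: SilvermanATAEC1994, Cor. IV.9.2 (d) and Table 4.1]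
[cite: Mazur1978, Cor. 4.1] [cite: Miller2011LMS, Def. 1.1 (arXiv:1010.2431 p. 3)] -/
theorem missingUpperBoundAt_of_valueDepth (hGZK : rank_eq_analyticRank_of_analyticRank_le_one)
    (hnf : exists_isNewformOf) (hMz : mazur_not_dvd_maninConstant_of_odd)
    {W : WeierstrassCurve ℚ} [W.IsElliptic] [W.IsGloballyMinimal] {p : ℕ} [Fact p.Prime]
    (hX : ClassX11a W p) (hp5 : 5 ≤ p) (hSha : ∀ x : W.sha, (p : ℤ) • x = 0 → x = 0)
    (hV : ∀ t : ℚ, W.entireLFunction 1 / (W.realPeriodRat : ℂ) = (t : ℂ) →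
      (padicValNat p W.tamagawaProduct : ℤ) ≤ padicValRat p t) :
    MissingUpperBoundAt W p := by
  obtain ⟨t, ht, ht0, -⟩ := hX.exists_LOne_div_realPeriod_eq_of_mazur hnf hMz hp5
  have hL1 : W.entireLFunction 1 ≠ 0 := by
    intro h0
    apply ht0
    have h : ((t : ℚ) : ℂ) = 0 := by rw [← ht, h0, zero_div]
    exact_mod_cast h
  obtain ⟨-, -, -, hsha⟩ := shaAn_eq_of_L_one_div_eq hGZK W hL1 ht
  have hvq := padicValRat_shaAn_eq_sub_tamagawa hGZK hnf hMz hX hp5 hsha ht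
  refine hX.missingUpperBoundAt_of_noPTorsion hGZK hsha ?_ hSha
  rw [hvq]
  have := hV t ht
  linarith

/-- **SOCKET for C_cc: value depth on the C_cc locus ⟹ C_cc (CONDITIONAL on GZK, modularity, Mazur Cor. 4.1).**  If at every X11a pair with `ρ̄` not surjective,
`5 ≤ p`, `ord_p ∏c ≥ 2` and `Ш(E)[p] = 0` the value `L(E,1)/Ω_E` has `ord_p ≥ ord_p ∏_ℓ c_ℓ`, then the depth core holds.  (Depth `≤ 1` is the CLOSED shallow ∕
exc-shallow sector, where the same inequality is the landed Tamagawa ∕ exceptional-zero divisibility.) [cite: Kato2004Asterisque, §17.13 (pp. 279–280)]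
[cite: Miller2011LMS, Def. 1.1 (arXiv:1010.2431 p. 3)] -/
theorem tamagawaDepthCore_of_valueDepth (hGZK : rank_eq_analyticRank_of_analyticRank_le_one)
    (hnf : exists_isNewformOf) (hMz : mazur_not_dvd_maninConstant_of_odd)
    (hV : ∀ (W : WeierstrassCurve ℚ) [W.IsElliptic] [W.IsGloballyMinimal] (p : ℕ) [Fact p.Prime],
      ClassX11a W p → ¬ Surj W p → 5 ≤ p → 2 ≤ padicValNat p W.tamagawaProduct →
      (∀ x : W.sha, (p : ℤ) • x = 0 → x = 0) →
      ∀ t : ℚ, W.entireLFunction 1 / (W.realPeriodRat : ℂ) = (t : ℂ) → (padicValNat p W.tamagawaProduct : ℤ) ≤ padicValRat p t) :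
    ∀ (W : WeierstrassCurve ℚ) [W.IsElliptic] [W.IsGloballyMinimal] (p : ℕ) [Fact p.Prime],
      ClassX11a W p → ¬ Surj W p → 5 ≤ p → 2 ≤ padicValNat p W.tamagawaProduct →
      (∀ x : W.sha, (p : ℤ) • x = 0 → x = 0) → MissingUpperBoundAt W p :=
  fun W _ _ p _ hX hns hp5 h2 hSha =>
    missingUpperBoundAt_of_valueDepth hGZK hnf hMz hX hp5 hSha (hV W p hX hns hp5 h2 hSha)

/-- **SOCKET for the populated stratum C_T2: value depth at the pairs with two split multiplicative primes ⟹ C_T2 (CONDITIONAL on GZK, modularity, Mazur Cor. 4.1).**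
This is the first rung an additivity road has to reach («(W) for two primes, all depths one» covers both census pairs 118080ds1 and 346560lh1).
[cite: Kato2004Asterisque, §17.13 (pp. 279–280)] [cite: Miller2011LMS, Def. 1.1 (arXiv:1010.2431 p. 3)] -/
theorem twoSplitCore_of_valueDepth (hGZK : rank_eq_analyticRank_of_analyticRank_le_one)
    (hnf : exists_isNewformOf) (hMz : mazur_not_dvd_maninConstant_of_odd)
    (hV : ∀ (W : WeierstrassCurve ℚ) [W.IsElliptic] [W.IsGloballyMinimal] (p : ℕ) [Fact p.Prime],
      ClassX11a W p → ¬ Surj W p → 5 ≤ p → (∀ x : W.sha, (p : ℤ) • x = 0 → x = 0) →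
      (∃ (ℓ₁ : ℕ) (_ : Fact ℓ₁.Prime) (ℓ₂ : ℕ) (_ : Fact ℓ₂.Prime), ℓ₁ ≠ ℓ₂ ∧
        W.HasSplitMultiplicativeReductionAtPrime ℓ₁ ∧ W.HasSplitMultiplicativeReductionAtPrime ℓ₂) →
      ∀ t : ℚ, W.entireLFunction 1 / (W.realPeriodRat : ℂ) = (t : ℂ) → (padicValNat p W.tamagawaProduct : ℤ) ≤ padicValRat p t) :
    ∀ (W : WeierstrassCurve ℚ) [W.IsElliptic] [W.IsGloballyMinimal] (p : ℕ) [Fact p.Prime],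
      ClassX11a W p → ¬ Surj W p → 5 ≤ p → (∀ x : W.sha, (p : ℤ) • x = 0 → x = 0) →
      (∃ (ℓ₁ : ℕ) (_ : Fact ℓ₁.Prime) (ℓ₂ : ℕ) (_ : Fact ℓ₂.Prime), ℓ₁ ≠ ℓ₂ ∧
        W.HasSplitMultiplicativeReductionAtPrime ℓ₁ ∧ W.HasSplitMultiplicativeReductionAtPrime ℓ₂) →
      MissingUpperBoundAt W p :=
  fun W _ _ p _ hX hns hp5 hSha htwo =>
    missingUpperBoundAt_of_valueDepth hGZK hnf hMz hX hp5 hSha (hV W p hX hns hp5 hSha htwo)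

/-! ## §4 Planner turnkey with the strata -/

/-- **PLANNER TURNKEY (rev 12 with C_cc by stratum): the eleven named facts + C_Ш + C_T1 + C_T2 ⟹ U5 BY NAME** — through `tamagawaDepthCore_iff_strata` and
`upperNonSurjFive_of_elevenFacts_of_twoCores`.  CONDITIONAL on the eleven displayed facts and on the three OPEN statements (U5 verbatim on sub-loci); credit nothing.
[cite: Kato2004Asterisque, Thm. 12.4 (p. 221), §17.13 (pp. 279–280)] [cite: DarmonDiamondTaylor1995, Thm. 3.15] [cite: Miller2011LMS, Def. 1.1 (arXiv:1010.2431 p. 3)] -/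
theorem upperNonSurjFive_of_elevenFacts_of_shaCore_of_strata
    (hJs : thm61_splitMultiplicative) (hJn : thm61_nonsplitMultiplicative)
    (h12 : Kato2004.thm12_4) (hnf : exists_isNewformOf)
    (hns' : Kato2004.exists_multDivisibilityInputs_nonsplit_contra)
    (hsp' : Kato2004.exists_multDivisibilityInputs_split_contra)
    (hfine' : Kato2004.exists_multDivisibilityInputs_fine_contra) (hMz : mazur_not_dvd_maninConstant_of_odd)
    (hGZK : rank_eq_analyticRank_of_analyticRank_le_one)
    (hCE : colemanEdixhoven1998_heckePolynomial_simpleRoots)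
    (hGV : greenbergVatsal2000_plusSymbol_congruence) (hI : ribet1984_iharaLemma)
    (hLL : ribet1990_levelLowering_gamma0_newform_general_of_five_le)
    (hC : ∀ (W : WeierstrassCurve ℚ) [W.IsElliptic] [W.IsGloballyMinimal] (p : ℕ) [Fact p.Prime],
      ClassX11a W p → ¬ Surj W p → 5 ≤ p → (∃ x : W.sha, (p : ℤ) • x = 0 ∧ x ≠ 0) → MissingUpperBoundAt W p)
    (hT1 : ∀ (W : WeierstrassCurve ℚ) [W.IsElliptic] [W.IsGloballyMinimal] (p : ℕ) [Fact p.Prime],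
      ClassX11a W p → ¬ Surj W p → 5 ≤ p → 2 ≤ padicValNat p W.tamagawaProduct →
      (∀ x : W.sha, (p : ℤ) • x = 0 → x = 0) →
      (∀ (ℓ₁ : ℕ) [Fact ℓ₁.Prime] (ℓ₂ : ℕ) [Fact ℓ₂.Prime],
        W.HasSplitMultiplicativeReductionAtPrime ℓ₁ → W.HasSplitMultiplicativeReductionAtPrime ℓ₂ → ℓ₁ = ℓ₂) →
      MissingUpperBoundAt W p)
    (hT2 : ∀ (W : WeierstrassCurve ℚ) [W.IsElliptic] [W.IsGloballyMinimal] (p : ℕ) [Fact p.Prime],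
      ClassX11a W p → ¬ Surj W p → 5 ≤ p → (∀ x : W.sha, (p : ℤ) • x = 0 → x = 0) →
      (∃ (ℓ₁ : ℕ) (_ : Fact ℓ₁.Prime) (ℓ₂ : ℕ) (_ : Fact ℓ₂.Prime), ℓ₁ ≠ ℓ₂ ∧
        W.HasSplitMultiplicativeReductionAtPrime ℓ₁ ∧ W.HasSplitMultiplicativeReductionAtPrime ℓ₂) →
      MissingUpperBoundAt W p) :
    PrintX11a.UpperNonSurjFive :=
  upperNonSurjFive_of_elevenFacts_of_twoCores hJs hJn h12 hnf hns' hsp' hfine' hMz hGZK hCE hGV hI hLL hC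
    (tamagawaDepthCore_iff_strata.2 ⟨hT1, hT2⟩)

end Summit.BirchSwinnertonDyer.BirchSwinnertonDyer.Theorems.GL1Cartan

end
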